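import Summits.ResolutionOfSingularities.ResolutionOfSingularities.Theorems.RisoStrataRtdLocalPad
import Summits.ResolutionOfSingularities.ResolutionOfSingularities.Theorems.RisoStrataRtdLocalCollapse
import Summits.ResolutionOfSingularities.ResolutionOfSingularities.Theorems.RisoStrataRtdLocalGl
import Summits.ResolutionOfSingularities.ResolutionOfSingularities.Theorems.RisoStrataRtdLocalSqDominated
import Summits.ResolutionOfSingularities.ResolutionOfSingularities.Theorems.RisoStrataRtdLocalCotangentSpan
import Summits.ResolutionOfSingularities.ResolutionOfSingularities.Theorems.RisoStrataRtdLocalArcEquiv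
import Summits.ResolutionOfSingularities.ResolutionOfSingularities.Theses.RisoStrata

/-!
# Crux `RtdLocal` (stmt-ResolutionOfSingularities-18840), line `Sketch`: COTANGENT INVARIANCE

Route `ResolutionOfSingularities/RisoStrata`. The typed riso-triviality predicate of the route
(clauses (1) rv-straightening, (2) positivity, (3) `W`-translation invariance, written INLINE
throughout — no definitions) evaluated on the arcs of ONE `k`-algebra `A` centred at a proper
ideal `n` does not depend on the finite family of coordinates used, as long as that family lies
in `n` and spans `n/n²`: for a presentation `g ⊆ n` of `A` and any family `p ⊆ n` with
`g ≡ N p (mod n²)` (constant matrix `N`), `Rtd(T g) r ↔ Rtd(T p) r` (`stub_invariance`, the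
lead stub of the line; typed Monreal arXiv:2606.12554 Prop 4.2 / Lemma 3.21 / Prop 4.4).

Proof = the five moves PAD ∘ SHEAR ∘ SWAP ∘ SHEAR ∘ COLLAPSE (`inv_chain`) on the landed stubs
`stub_pad`, `stub_gl`, `stub_collapse`, with the two domination inputs: `n²` is strictly
dominated by the presentation `g` (`stub_sq_dominated`) and hence by `p` (`inv_dom_span`:
`v(Δg_j) = v(Σ N Δp + Δq)` forces some `v(Δp_j') ≤ v(Δg_j)`).
-/

set_option linter.dupNamespace false

namespace Summit.ResolutionOfSingularities.ResolutionOfSingularities.Theorems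

section PointSet

variable {k : Type} [Field k]

/-- Reindexing the coordinates along `e : J ≃ J₂` preserves the typed predicate
(`W ↦ W ∘ e⁻¹`, `φ ↦ φ ∘ e⁻¹`). -/
theorem inv_reindexCoords {ι J J₂ : Type} [Fintype J] [Fintype J₂] (e : J ≃ J₂)
    (c : ι → J → HahnSeries ℚ k) (r : ℕ)
    (h : ∃ W : Submodule k (J → k), r ≤ Module.finrank k W ∧
      ∃ φ : ι → J → HahnSeries ℚ k,
        (∀ a b, a ≠ b → ∃ j, ∀ i,
          (c a j - c b j).orderTop < ((φ a i - φ b i) - (c a i - c b i)).orderTop) ∧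
        (∀ a i, 0 < (φ a i).orderTop) ∧
        (∀ a (w : J → HahnSeries ℚ k), (∀ i, 0 < (w i).orderTop) →
          w ∈ Submodule.span (HahnSeries ℚ k)
            ((fun u : J → k => fun i => HahnSeries.C (u i)) '' (W : Set (J → k))) →
          ∃ b, φ b = φ a + w)) :
    ∃ W : Submodule k (J₂ → k), r ≤ Module.finrank k W ∧
      ∃ φ : ι → J₂ → HahnSeries ℚ k,
        (∀ a b, a ≠ b → ∃ j, ∀ i,
          (c a (e.symm j) - c b (e.symm j)).orderTop <
            ((φ a i - φ b i) - (c a (e.symm i) - c b (e.symm i))).orderTop) ∧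
        (∀ a i, 0 < (φ a i).orderTop) ∧
        (∀ a (w : J₂ → HahnSeries ℚ k), (∀ i, 0 < (w i).orderTop) →
          w ∈ Submodule.span (HahnSeries ℚ k)
            ((fun u : J₂ → k => fun i => HahnSeries.C (u i)) '' (W : Set (J₂ → k))) →
          ∃ b, φ b = φ a + w) := by
  obtain ⟨W, hW, φ, h1, h2, h3⟩ := h
  let F : (J → k) ≃ₗ[k] (J₂ → k) := LinearEquiv.funCongrLeft k k e.symm
  let FH : (J → HahnSeries ℚ k) ≃ₗ[HahnSeries ℚ k] (J₂ → HahnSeries ℚ k) :=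
    LinearEquiv.funCongrLeft (HahnSeries ℚ k) (HahnSeries ℚ k) e.symm
  have hF : ∀ u j₂, F u j₂ = u (e.symm j₂) := fun _ _ => rfl
  have hFH : ∀ x j₂, FH x j₂ = x (e.symm j₂) := fun _ _ => rfl
  refine ⟨W.map (F : (J → k) →ₗ[k] (J₂ → k)), ?_, fun a j₂ => φ a (e.symm j₂), ?_, ?_, ?_⟩
  · rw [LinearEquiv.finrank_map_eq]
    exact hW
  · intro a b hab
    obtain ⟨j, hj⟩ := h1 a b hab
    refine ⟨e j, fun i => ?_⟩
    rw [Equiv.symm_apply_apply]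
    exact hj (e.symm i)
  · intro a i
    exact h2 a (e.symm i)
  · intro a w hw hwspan
    have hset : ((fun u : J₂ → k => fun i => HahnSeries.C (u i)) ''
          (W.map (F : (J → k) →ₗ[k] (J₂ → k)) : Set (J₂ → k))) =
        (FH : (J → HahnSeries ℚ k) →ₗ[HahnSeries ℚ k] (J₂ → HahnSeries ℚ k)) ''
          ((fun u : J → k => fun i => HahnSeries.C (u i)) '' (W : Set (J → k))) := by
      rw [Submodule.map_coe, Set.image_image, Set.image_image]
      rfl
    rw [hset, Submodule.span_image] at hwspan
    obtain ⟨w₀, hw₀, hw₀w⟩ := hwspan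
    have hw₀' : ∀ i, 0 < (w₀ i).orderTop := by
      intro i
      have := hw (e i)
      rw [← hw₀w] at this
      change 0 < (FH w₀ (e i)).orderTop at this
      rwa [hFH, Equiv.symm_apply_apply] at this
    obtain ⟨b, hb⟩ := h3 a w₀ hw₀' hw₀
    refine ⟨b, ?_⟩
    funext j₂
    rw [← hw₀w]
    change φ b (e.symm j₂) = φ a (e.symm j₂) + FH w₀ j₂
    rw [hb, hFH, Pi.add_apply]

/-- Swapping the two blocks preserves the typed predicate. -/
theorem inv_swap {ι J J' : Type} [Fintype J] [Fintype J']
    (c : ι → J → HahnSeries ℚ k) (d : ι → J' → HahnSeries ℚ k) (r : ℕ)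
    (h : ∃ W : Submodule k (J ⊕ J' → k), r ≤ Module.finrank k W ∧
      ∃ φ : ι → J ⊕ J' → HahnSeries ℚ k,
        (∀ a b, a ≠ b → ∃ j, ∀ i,
          (Sum.elim (c a) (d a) j - Sum.elim (c b) (d b) j).orderTop <
            ((φ a i - φ b i) - (Sum.elim (c a) (d a) i - Sum.elim (c b) (d b) i)).orderTop) ∧
        (∀ a i, 0 < (φ a i).orderTop) ∧
        (∀ a (w : J ⊕ J' → HahnSeries ℚ k), (∀ i, 0 < (w i).orderTop) →
          w ∈ Submodule.span (HahnSeries ℚ k)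
            ((fun u : J ⊕ J' → k => fun i => HahnSeries.C (u i)) '' (W : Set (J ⊕ J' → k))) →
          ∃ b, φ b = φ a + w)) :
    ∃ W : Submodule k (J' ⊕ J → k), r ≤ Module.finrank k W ∧
      ∃ φ : ι → J' ⊕ J → HahnSeries ℚ k,
        (∀ a b, a ≠ b → ∃ j, ∀ i,
          (Sum.elim (d a) (c a) j - Sum.elim (d b) (c b) j).orderTop <
            ((φ a i - φ b i) - (Sum.elim (d a) (c a) i - Sum.elim (d b) (c b) i)).orderTop) ∧
        (∀ a i, 0 < (φ a i).orderTop) ∧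
        (∀ a (w : J' ⊕ J → HahnSeries ℚ k), (∀ i, 0 < (w i).orderTop) →
          w ∈ Submodule.span (HahnSeries ℚ k)
            ((fun u : J' ⊕ J → k => fun i => HahnSeries.C (u i)) '' (W : Set (J' ⊕ J → k))) →
          ∃ b, φ b = φ a + w) := by
  have key : ∀ (a : ι) (j : J' ⊕ J),
      Sum.elim (c a) (d a) ((Equiv.sumComm J J').symm j) = Sum.elim (d a) (c a) j := by
    intro a j
    cases j <;> rfl
  have h' := inv_reindexCoords (Equiv.sumComm J J') (fun a => Sum.elim (c a) (d a)) r h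
  simp only [key] at h'
  exact h'

/-- SHEAR: adding a CONSTANT-matrix multiple of the first block to the second block preserves
the typed predicate (`stub_gl` with the unipotent block matrix `[[1, 0], [N, 1]]`). -/
theorem inv_shear {ι J J' : Type} [Fintype J] [Fintype J']
    (c : ι → J → HahnSeries ℚ k) (d d' : ι → J' → HahnSeries ℚ k) (N : Matrix J' J k)
    (hd' : ∀ a i, d' a i = d a i + (N.map HahnSeries.C).mulVec (c a) i) (r : ℕ)
    (h : ∃ W : Submodule k (J ⊕ J' → k), r ≤ Module.finrank k W ∧
      ∃ φ : ι → J ⊕ J' → HahnSeries ℚ k,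
        (∀ a b, a ≠ b → ∃ j, ∀ i,
          (Sum.elim (c a) (d a) j - Sum.elim (c b) (d b) j).orderTop <
            ((φ a i - φ b i) - (Sum.elim (c a) (d a) i - Sum.elim (c b) (d b) i)).orderTop) ∧
        (∀ a i, 0 < (φ a i).orderTop) ∧
        (∀ a (w : J ⊕ J' → HahnSeries ℚ k), (∀ i, 0 < (w i).orderTop) →
          w ∈ Submodule.span (HahnSeries ℚ k)
            ((fun u : J ⊕ J' → k => fun i => HahnSeries.C (u i)) '' (W : Set (J ⊕ J' → k))) →
          ∃ b, φ b = φ a + w)) :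
    ∃ W : Submodule k (J ⊕ J' → k), r ≤ Module.finrank k W ∧
      ∃ φ : ι → J ⊕ J' → HahnSeries ℚ k,
        (∀ a b, a ≠ b → ∃ j, ∀ i,
          (Sum.elim (c a) (d' a) j - Sum.elim (c b) (d' b) j).orderTop <
            ((φ a i - φ b i) - (Sum.elim (c a) (d' a) i - Sum.elim (c b) (d' b) i)).orderTop) ∧
        (∀ a i, 0 < (φ a i).orderTop) ∧
        (∀ a (w : J ⊕ J' → HahnSeries ℚ k), (∀ i, 0 < (w i).orderTop) →
          w ∈ Submodule.span (HahnSeries ℚ k)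
            ((fun u : J ⊕ J' → k => fun i => HahnSeries.C (u i)) '' (W : Set (J ⊕ J' → k))) →
          ∃ b, φ b = φ a + w) := by
  classical
  let M : Matrix (J ⊕ J') (J ⊕ J') k := Matrix.fromBlocks 1 0 N 1
  have hM : IsUnit M.det := by
    simp [M]
  have key : ∀ a, (M.map HahnSeries.C).mulVec (Sum.elim (c a) (d a)) =
      Sum.elim (c a) (d' a) := by
    intro a
    have h0 : (0 : Matrix J J' k).map HahnSeries.C = (0 : Matrix J J' (HahnSeries ℚ k)) := by
      ext i j
      simp
    have h1 : (1 : Matrix J J k).map HahnSeries.C = (1 : Matrix J J (HahnSeries ℚ k)) :=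
      Matrix.map_one _ (map_zero _) (map_one _)
    have h1' : (1 : Matrix J' J' k).map HahnSeries.C = (1 : Matrix J' J' (HahnSeries ℚ k)) :=
      Matrix.map_one _ (map_zero _) (map_one _)
    rw [Matrix.fromBlocks_map, Matrix.fromBlocks_mulVec, h0, h1, h1', Sum.elim_comp_inl,
      Sum.elim_comp_inr, Matrix.one_mulVec, Matrix.zero_mulVec, Matrix.one_mulVec, add_zero]
    congr 1
    funext i
    rw [hd', Pi.add_apply, add_comm]
  have hgl := stub_gl (fun a => Sum.elim (c a) (d a)) M hM r h
  simp only [key] at hgl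
  exact hgl

/-- If `x = Σ_j' C(N_j') y_j' + q` with `v(x) < v(q)`, then some `v(y_j') ≤ v(x)`
(ultrametric inequality: constants do not lower orders). -/
theorem inv_exists_le_of_eq_sum {J' : Type} [Fintype J'] (x q : HahnSeries ℚ k)
    (y : J' → HahnSeries ℚ k) (N : J' → k)
    (hx : x = ∑ j', HahnSeries.C (N j') * y j' + q) (hq : x.orderTop < q.orderTop) :
    ∃ j', (y j').orderTop ≤ x.orderTop := by
  by_contra hcon
  have hall : ∀ j', x.orderTop < (y j').orderTop := fun j' =>
    lt_of_not_ge fun h => hcon ⟨j', h⟩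
  have hμ : x.orderTop ≠ ⊤ := ne_top_of_lt hq
  have hsum : x.orderTop < (∑ j', HahnSeries.C (N j') * y j').orderTop :=
    gl_lt_orderTop_sum _ _ _ hμ fun j' _ => by
      rw [HahnSeries.C_mul_eq_smul]
      exact (hall j').trans_le (HahnSeries.orderTop_le_orderTop_smul _ _)
  have : x.orderTop < x.orderTop := by
    conv_rhs => rw [hx]
    exact (lt_min hsum hq).trans_le HahnSeries.min_orderTop_le_orderTop_add
  exact lt_irrefl _ this

/-- The five-move CHAIN (pad ∘ shear ∘ swap ∘ shear ∘ collapse): if `y = q₁ + N₁ x` with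
`q₁` strictly dominated by `x`, and `q₂ = x - N₂ y` is strictly dominated by `y`, then the typed
predicate passes from the coordinates `x` to the coordinates `y`. -/
theorem inv_chain {ι J J' : Type} [Fintype J] [Fintype J'] [Nonempty ι]
    (x : ι → J → HahnSeries ℚ k) (y : ι → J' → HahnSeries ℚ k)
    (q₁ : ι → J' → HahnSeries ℚ k) (q₂ : ι → J → HahnSeries ℚ k)
    (N₁ : Matrix J' J k) (N₂ : Matrix J J' k)
    (hq₁ : ∀ a i, y a i = q₁ a i + (N₁.map HahnSeries.C).mulVec (x a) i)
    (hq₂ : ∀ a j, q₂ a j = x a j + ((-N₂).map HahnSeries.C).mulVec (y a) j)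
    (hdom₁ : ∀ a b, a ≠ b → ∃ j, ∀ i, (x a j - x b j).orderTop < (q₁ a i - q₁ b i).orderTop)
    (hdom₂ : ∀ a b, a ≠ b → ∃ j, ∀ i, (y a j - y b j).orderTop < (q₂ a i - q₂ b i).orderTop)
    (r : ℕ)
    (h : ∃ W : Submodule k (J → k), r ≤ Module.finrank k W ∧
      ∃ φ : ι → J → HahnSeries ℚ k,
        (∀ a b, a ≠ b → ∃ j, ∀ i,
          (x a j - x b j).orderTop < ((φ a i - φ b i) - (x a i - x b i)).orderTop) ∧
        (∀ a i, 0 < (φ a i).orderTop) ∧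
        (∀ a (w : J → HahnSeries ℚ k), (∀ i, 0 < (w i).orderTop) →
          w ∈ Submodule.span (HahnSeries ℚ k)
            ((fun u : J → k => fun i => HahnSeries.C (u i)) '' (W : Set (J → k))) →
          ∃ b, φ b = φ a + w)) :
    ∃ W : Submodule k (J' → k), r ≤ Module.finrank k W ∧
      ∃ φ : ι → J' → HahnSeries ℚ k,
        (∀ a b, a ≠ b → ∃ j, ∀ i,
          (y a j - y b j).orderTop < ((φ a i - φ b i) - (y a i - y b i)).orderTop) ∧
        (∀ a i, 0 < (φ a i).orderTop) ∧
        (∀ a (w : J' → HahnSeries ℚ k), (∀ i, 0 < (w i).orderTop) →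
          w ∈ Submodule.span (HahnSeries ℚ k)
            ((fun u : J' → k => fun i => HahnSeries.C (u i)) '' (W : Set (J' → k))) →
          ∃ b, φ b = φ a + w) := by
  have h1 := stub_pad x q₁ hdom₁ r h
  have h2 := inv_shear x q₁ y N₁ hq₁ r h1
  have h3 := inv_swap x y r h2
  have h4 := inv_shear y x q₂ (-N₂) hq₂ r h3
  exact stub_collapse y q₂ hdom₂ r h4

end PointSet

section Algebra

variable {k : Type} [Field k] {A : Type} [CommRing A] [Algebra k A]

/-- Arcs are `k`-linear: they turn a `k`-combination of elements into the corresponding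
`C`-combination of values. -/
theorem inv_arc_sub_sum (a : A →ₐ[k] HahnSeries ℚ k) {J' : Type} [Fintype J'] (z : A)
    (N : J' → k) (p : J' → A) :
    a (z - ∑ j', algebraMap k A (N j') * p j') =
      a z - ∑ j', HahnSeries.C (N j') * a (p j') := by
  simp [map_sum, arcEquiv_algebraMap_eq_C]

/-- `n²` is strictly dominated by a presentation `g ⊆ n` on distinct centred arcs
(`stub_sq_dominated`, family form). -/
theorem inv_dom_gen (n : Ideal A) {J I : Type} [Fintype J] (g : J → A) (hg : ∀ j, g j ∈ n)
    (hgen : Algebra.adjoin k (Set.range g) = ⊤) (q : I → A) (hq : ∀ i, q i ∈ n ^ 2)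
    (a b : {α : A →ₐ[k] HahnSeries ℚ k // ∀ x ∈ n, 0 < (α x).orderTop}) (hab : a ≠ b) :
    ∃ j, ∀ i, (a.1 (g j) - b.1 (g j)).orderTop < (a.1 (q i) - b.1 (q i)).orderTop := by
  obtain ⟨j, -, hj⟩ := stub_sq_dominated n g hg hgen a.1 b.1 a.2 b.2
    (fun h => hab (Subtype.ext h))
  exact ⟨j, fun i => hj _ (hq i)⟩

/-- `n²` is strictly dominated, on distinct centred arcs, by ANY family `p ⊆ n` that spans
`n/n²` (i.e. such that a presentation `g` is `≡ N p (mod n²)`): the least `v(Δg_j)` is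
`v(Σ N Δp + Δq₀)` with `v(Δq₀)` larger, so some `v(Δp_j') ≤ v(Δg_j)`. -/
theorem inv_dom_span (n : Ideal A) {J J' I : Type} [Fintype J] [Fintype J'] (g : J → A)
    (hg : ∀ j, g j ∈ n) (hgen : Algebra.adjoin k (Set.range g) = ⊤) (p : J' → A)
    (N : J → J' → k) (hN : ∀ j, g j - ∑ j', algebraMap k A (N j j') * p j' ∈ n ^ 2)
    (q : I → A) (hq : ∀ i, q i ∈ n ^ 2)
    (a b : {α : A →ₐ[k] HahnSeries ℚ k // ∀ x ∈ n, 0 < (α x).orderTop}) (hab : a ≠ b) :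
    ∃ j', ∀ i, (a.1 (p j') - b.1 (p j')).orderTop < (a.1 (q i) - b.1 (q i)).orderTop := by
  obtain ⟨j, -, hj⟩ := stub_sq_dominated n g hg hgen a.1 b.1 a.2 b.2
    (fun h => hab (Subtype.ext h))
  have hq₀ := hj _ (hN j)
  have hx : a.1 (g j) - b.1 (g j) =
      ∑ j', HahnSeries.C (N j j') * (a.1 (p j') - b.1 (p j')) +
        (a.1 (g j - ∑ j', algebraMap k A (N j j') * p j') -
          b.1 (g j - ∑ j', algebraMap k A (N j j') * p j')) := by
    rw [inv_arc_sub_sum, inv_arc_sub_sum]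
    simp only [mul_sub, Finset.sum_sub_distrib]
    ring
  obtain ⟨j', hj'⟩ := inv_exists_le_of_eq_sum _ _ _ _ hx hq₀
  exact ⟨j', fun i => hj'.trans_lt (hj _ (hq i))⟩

/-- **COTANGENT INVARIANCE** (lead stub of line `Sketch`; typed Monreal Prop 4.2 / Lemma 3.21 /
Prop 4.4): inside one `k`-algebra `A` with arcs centred at a proper ideal `n` (at least one arc),
for a presentation `g ⊆ n` of `A` and any finite family `p ⊆ n` with `g ≡ N p (mod n²)`, the
typed riso-triviality predicate for the coordinates `g` holds iff it holds for the coordinates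
`p`. -/
theorem stub_invariance {k : Type} [Field k] {A : Type} [CommRing A] [Algebra k A]
    (n : Ideal A) (hn : n ≠ ⊤) {J J' : Type} [Fintype J] [Fintype J']
    (g : J → A) (hg : ∀ j, g j ∈ n) (hgen : Algebra.adjoin k (Set.range g) = ⊤)
    (p : J' → A) (hp : ∀ j, p j ∈ n) (N : J → J' → k)
    (hN : ∀ j, g j - ∑ j', algebraMap k A (N j j') * p j' ∈ n ^ 2)
    (hne : Nonempty {α : A →ₐ[k] HahnSeries ℚ k // ∀ x ∈ n, 0 < (α x).orderTop}) (r : ℕ) :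
    (∃ W : Submodule k (J → k), r ≤ Module.finrank k W ∧
      ∃ φ : {α : A →ₐ[k] HahnSeries ℚ k // ∀ x ∈ n, 0 < (α x).orderTop} → J → HahnSeries ℚ k,
        (∀ a b : {α : A →ₐ[k] HahnSeries ℚ k // ∀ x ∈ n, 0 < (α x).orderTop}, a ≠ b →
          ∃ j, ∀ i, (a.1 (g j) - b.1 (g j)).orderTop <
            ((φ a i - φ b i) - (a.1 (g i) - b.1 (g i))).orderTop) ∧
        (∀ a i, 0 < (φ a i).orderTop) ∧
        (∀ a (w : J → HahnSeries ℚ k), (∀ i, 0 < (w i).orderTop) →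
          w ∈ Submodule.span (HahnSeries ℚ k)
            ((fun u : J → k => fun i => HahnSeries.C (u i)) '' (W : Set (J → k))) →
          ∃ b, φ b = φ a + w)) ↔
    (∃ W : Submodule k (J' → k), r ≤ Module.finrank k W ∧
      ∃ φ : {α : A →ₐ[k] HahnSeries ℚ k // ∀ x ∈ n, 0 < (α x).orderTop} → J' → HahnSeries ℚ k,
        (∀ a b : {α : A →ₐ[k] HahnSeries ℚ k // ∀ x ∈ n, 0 < (α x).orderTop}, a ≠ b →
          ∃ j, ∀ i, (a.1 (p j) - b.1 (p j)).orderTop <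
            ((φ a i - φ b i) - (a.1 (p i) - b.1 (p i))).orderTop) ∧
        (∀ a i, 0 < (φ a i).orderTop) ∧
        (∀ a (w : J' → HahnSeries ℚ k), (∀ i, 0 < (w i).orderTop) →
          w ∈ Submodule.span (HahnSeries ℚ k)
            ((fun u : J' → k => fun i => HahnSeries.C (u i)) '' (W : Set (J' → k))) →
          ∃ b, φ b = φ a + w)) := by
  classical
  haveI := hne
  -- the converse congruence: `p ≡ N₂ g (mod n²)` (first-order expansion along `g`)
  have hN₂ : ∀ j', ∃ u : J → k, p j' - ∑ j, algebraMap k A (u j) * g j ∈ n ^ 2 :=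
    fun j' => cotspan_firstOrder_of_mem n hn g hg hgen (p j') (hp j')
  choose N₂ hN₂ using hN₂
  -- linearity of arcs on the two congruences
  have lin₁ : ∀ (a : {α : A →ₐ[k] HahnSeries ℚ k // ∀ x ∈ n, 0 < (α x).orderTop}) (j' : J'),
      a.1 (p j') = a.1 (p j' - ∑ j, algebraMap k A (N₂ j' j) * g j) +
        ((Matrix.of fun j' j => N₂ j' j).map HahnSeries.C).mulVec (fun j => a.1 (g j)) j' := by
    intro a j'
    rw [inv_arc_sub_sum]
    simp [Matrix.mulVec, dotProduct]
  have lin₂ : ∀ (a : {α : A →ₐ[k] HahnSeries ℚ k // ∀ x ∈ n, 0 < (α x).orderTop}) (j : J),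
      a.1 (g j) = a.1 (g j - ∑ j', algebraMap k A (N j j') * p j') +
        ((Matrix.of fun j j' => N j j').map HahnSeries.C).mulVec (fun j' => a.1 (p j')) j := by
    intro a j
    rw [inv_arc_sub_sum]
    simp [Matrix.mulVec, dotProduct]
  have lin₁' : ∀ (a : {α : A →ₐ[k] HahnSeries ℚ k // ∀ x ∈ n, 0 < (α x).orderTop}) (j' : J'),
      a.1 (p j' - ∑ j, algebraMap k A (N₂ j' j) * g j) = a.1 (p j') +
        ((-(Matrix.of fun j' j => N₂ j' j)).map HahnSeries.C).mulVec (fun j => a.1 (g j)) j' := by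
    intro a j'
    rw [inv_arc_sub_sum]
    simp [Matrix.mulVec, dotProduct, Finset.sum_neg_distrib, sub_eq_add_neg]
  have lin₂' : ∀ (a : {α : A →ₐ[k] HahnSeries ℚ k // ∀ x ∈ n, 0 < (α x).orderTop}) (j : J),
      a.1 (g j - ∑ j', algebraMap k A (N j j') * p j') = a.1 (g j) +
        ((-(Matrix.of fun j j' => N j j')).map HahnSeries.C).mulVec (fun j' => a.1 (p j')) j := by
    intro a j
    rw [inv_arc_sub_sum]
    simp [Matrix.mulVec, dotProduct, Finset.sum_neg_distrib, sub_eq_add_neg]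
  -- the two domination inputs
  have domG := fun (a b : {α : A →ₐ[k] HahnSeries ℚ k // ∀ x ∈ n, 0 < (α x).orderTop})
      (hab : a ≠ b) => inv_dom_gen n g hg hgen
        (fun j' => p j' - ∑ j, algebraMap k A (N₂ j' j) * g j) hN₂ a b hab
  have domP := fun (a b : {α : A →ₐ[k] HahnSeries ℚ k // ∀ x ∈ n, 0 < (α x).orderTop})
      (hab : a ≠ b) => inv_dom_span n g hg hgen p N hN
        (fun j => g j - ∑ j', algebraMap k A (N j j') * p j') hN a b hab
  constructor
  · intro h
    exact inv_chain (fun (a : {α : A →ₐ[k] HahnSeries ℚ k // ∀ x ∈ n, 0 < (α x).orderTop}) j => a.1 (g j)) (fun (a : {α : A →ₐ[k] HahnSeries ℚ k // ∀ x ∈ n, 0 < (α x).orderTop}) j' => a.1 (p j'))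
      (fun (a : {α : A →ₐ[k] HahnSeries ℚ k // ∀ x ∈ n, 0 < (α x).orderTop}) j' => a.1 (p j' - ∑ j, algebraMap k A (N₂ j' j) * g j))
      (fun (a : {α : A →ₐ[k] HahnSeries ℚ k // ∀ x ∈ n, 0 < (α x).orderTop}) j => a.1 (g j - ∑ j', algebraMap k A (N j j') * p j'))
      (Matrix.of fun j' j => N₂ j' j) (Matrix.of fun j j' => N j j') lin₁ lin₂' domG domP r h
  · intro h
    exact inv_chain (fun (a : {α : A →ₐ[k] HahnSeries ℚ k // ∀ x ∈ n, 0 < (α x).orderTop}) j' => a.1 (p j')) (fun (a : {α : A →ₐ[k] HahnSeries ℚ k // ∀ x ∈ n, 0 < (α x).orderTop}) j => a.1 (g j))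
      (fun (a : {α : A →ₐ[k] HahnSeries ℚ k // ∀ x ∈ n, 0 < (α x).orderTop}) j => a.1 (g j - ∑ j', algebraMap k A (N j j') * p j'))
      (fun (a : {α : A →ₐ[k] HahnSeries ℚ k // ∀ x ∈ n, 0 < (α x).orderTop}) j' => a.1 (p j' - ∑ j, algebraMap k A (N₂ j' j) * g j))
      (Matrix.of fun j j' => N j j') (Matrix.of fun j' j => N₂ j' j) lin₂ lin₁' domP domG r h

end Algebra

end Summit.ResolutionOfSingularities.ResolutionOfSingularities.Theorems


/-!
# Crux `RtdLocal` of route RisoStrata (stmt-ResolutionOfSingularities-18840) — assembly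

Zariski-locality of the typed riso-triviality dimension under `B ↦ B' := B[s⁻¹]`
(Monreal, arXiv:2606.12554, Prop 4.2 / Lemma 3.21 / Prop 4.4 / Cor 4.6, in the route's
Hahn-series encoding; characteristic-free): for a finitely generated `k`-subalgebra `B` of a
field `K`, `0 ≠ s ∈ B`, and a maximal ideal `m'` of `B'` contracting to `m`,
`Rtd B' m' r ↔ Rtd B m r`.

Line `Sketch` (lead file). Ingredients, all landed under `Theorems/RisoStrataRtdLocal*.lean`:
cotangent invariance inside one algebra (`stub_invariance`), the arc bijection
`Arc B m ≃ Arc B' m'` (`stub_arcEquiv`), and "a presentation `g₀ ⊆ m` of `B` spans `m'/m'²`"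
(`stub_cotangent_span`). Assembly:
* (→) `Rtd B' m' r` via `g'` ⟹ invariance in `B'` from `g'` to `incl ∘ g₀` (`g₀ ⊆ m` a
  presentation of `B`, from `B.FG` and `B/m = k`) ⟹ reindex the arcs ⟹ `Rtd B m r` via `g₀`;
* (←) `Rtd B m r` via `g` ⟹ reindex the arcs ⟹ invariance in `B'` from the presentation
  `(u, incl ∘ g)` of `B'` inside `m'` (`u := s⁻¹ - c⁻¹`, `s ≡ c mod m`) to `incl ∘ g`, read
  backwards ⟹ `Rtd B' m' r`.
`IsAlgClosed`, `CharP` and maximality of `m'` beyond `m' ≠ ⊤` are not used; `B.FG` and `s ∈ B`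
are (they are load-bearing: `Theorems/RtdLocal/Negative/*`).
-/

set_option linter.dupNamespace false

namespace Summit.ResolutionOfSingularities.ResolutionOfSingularities.Theorems

section General

variable {k : Type} [Field k]

/-- Reindexing the ARCS along a bijection `e : ι ≃ ι'` compatible with the coordinates
transports the typed predicate. -/
theorem fin_reindexArcs {ι ι' J : Type} [Fintype J] (e : ι ≃ ι')
    (c : ι → J → HahnSeries ℚ k) (c' : ι' → J → HahnSeries ℚ k)
    (hc : ∀ a j, c' (e a) j = c a j) (r : ℕ)
    (h : ∃ W : Submodule k (J → k), r ≤ Module.finrank k W ∧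
      ∃ φ : ι → J → HahnSeries ℚ k,
        (∀ a b, a ≠ b → ∃ j, ∀ i,
          (c a j - c b j).orderTop < ((φ a i - φ b i) - (c a i - c b i)).orderTop) ∧
        (∀ a i, 0 < (φ a i).orderTop) ∧
        (∀ a (w : J → HahnSeries ℚ k), (∀ i, 0 < (w i).orderTop) →
          w ∈ Submodule.span (HahnSeries ℚ k)
            ((fun u : J → k => fun i => HahnSeries.C (u i)) '' (W : Set (J → k))) →
          ∃ b, φ b = φ a + w)) :
    ∃ W : Submodule k (J → k), r ≤ Module.finrank k W ∧
      ∃ φ : ι' → J → HahnSeries ℚ k,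
        (∀ a b, a ≠ b → ∃ j, ∀ i,
          (c' a j - c' b j).orderTop < ((φ a i - φ b i) - (c' a i - c' b i)).orderTop) ∧
        (∀ a i, 0 < (φ a i).orderTop) ∧
        (∀ a (w : J → HahnSeries ℚ k), (∀ i, 0 < (w i).orderTop) →
          w ∈ Submodule.span (HahnSeries ℚ k)
            ((fun u : J → k => fun i => HahnSeries.C (u i)) '' (W : Set (J → k))) →
          ∃ b, φ b = φ a + w) := by
  obtain ⟨W, hW, φ, h1, h2, h3⟩ := h
  have hc' : ∀ a' j, c' a' j = c (e.symm a') j := fun a' j => by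
    rw [← hc, Equiv.apply_symm_apply]
  refine ⟨W, hW, fun a' => φ (e.symm a'), ?_, fun a' i => h2 _ i, ?_⟩
  · intro a' b' hab
    obtain ⟨j, hj⟩ := h1 (e.symm a') (e.symm b') (fun h => hab (e.symm.injective h))
    refine ⟨j, fun i => ?_⟩
    simpa only [hc'] using hj i
  · intro a' w hw hwspan
    obtain ⟨b, hb⟩ := h3 (e.symm a') w hw hwspan
    refine ⟨e b, ?_⟩
    change φ (e.symm (e b)) = φ (e.symm a') + w
    rw [Equiv.symm_apply_apply, hb]

variable {A : Type} [CommRing A] [Algebra k A]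

/-- A presentation inside the ideal `n` forces residue ring `k`: every element is congruent to a
constant modulo `n`. -/
theorem fin_residue (n : Ideal A) {J : Type} [Fintype J] (g : J → A) (hg : ∀ j, g j ∈ n)
    (hgen : Algebra.adjoin k (Set.range g) = ⊤) (x : A) : ∃ c : k, x - algebraMap k A c ∈ n := by
  obtain ⟨c, u, h⟩ := cotspan_firstOrder n g hg hgen x
  refine ⟨c, ?_⟩
  have h1 : x - algebraMap k A c - ∑ j, algebraMap k A (u j) * g j ∈ n :=
    Ideal.pow_le_self two_ne_zero h
  have h2 : ∑ j, algebraMap k A (u j) * g j ∈ n :=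
    Ideal.sum_mem _ fun j _ => n.mul_mem_left _ (hg j)
  simpa using add_mem h1 h2

/-- The CONSTANT ARC: if `n` is proper with residue ring `k`, the composite
`A → A/n ≅ k → k⟦t^ℚ⟧` is an arc centred at `n`; so the arc space is inhabited. -/
theorem fin_nonempty_arc (n : Ideal A) (hn : n ≠ ⊤)
    (hres : ∀ x : A, ∃ c : k, x - algebraMap k A c ∈ n) :
    Nonempty {α : A →ₐ[k] HahnSeries ℚ k // ∀ x ∈ n, 0 < (α x).orderTop} := by
  haveI : Nontrivial (A ⧸ n) := Ideal.Quotient.nontrivial_iff.mpr hn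
  have hinj : Function.Injective (algebraMap k (A ⧸ n)) := (algebraMap k (A ⧸ n)).injective
  have hsurj : Function.Surjective (algebraMap k (A ⧸ n)) := by
    intro y
    obtain ⟨x, rfl⟩ := Ideal.Quotient.mk_surjective y
    obtain ⟨c, hc⟩ := hres x
    refine ⟨c, ?_⟩
    rw [IsScalarTower.algebraMap_apply k A (A ⧸ n), Ideal.Quotient.algebraMap_eq, eq_comm,
      Ideal.Quotient.mk_eq_mk_iff_sub_mem]
    exact hc
  let e : k ≃ₐ[k] (A ⧸ n) := AlgEquiv.ofBijective (Algebra.ofId k (A ⧸ n)) ⟨hinj, hsurj⟩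
  let α : A →ₐ[k] HahnSeries ℚ k :=
    (Algebra.ofId k (HahnSeries ℚ k)).comp (e.symm.toAlgHom.comp (Ideal.Quotient.mkₐ k n))
  refine ⟨⟨α, fun b hb => ?_⟩⟩
  have h0 : Ideal.Quotient.mk n b = 0 := Ideal.Quotient.eq_zero_iff_mem.2 hb
  simp [α, Ideal.Quotient.mkₐ_eq_mk, h0]

variable {K : Type} [Field K] [Algebra k K]

/-- A family of elements of a subalgebra `S ⊆ K` that generates `S` inside `K` generates `⊤`
inside `↥S`. -/
theorem fin_adjoin_top (S : Subalgebra k K) {J : Type} (g : J → ↥S)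
    (hgen : Algebra.adjoin k (Set.range fun j => (g j : K)) = S) :
    Algebra.adjoin k (Set.range g) = ⊤ := by
  apply Subalgebra.map_injective (f := S.val) Subtype.val_injective
  rw [Algebra.map_top, Subalgebra.range_val, AlgHom.map_adjoin, ← Set.range_comp]
  exact hgen

/-- A finitely generated `B ⊆ K` with residue ring `k` at `m` has a presentation INSIDE `m`
(shift the generators by their residues). This is where `B.FG` is consumed. -/
theorem fin_exists_presentation (B : Subalgebra k K) (hFG : B.FG) (m : Ideal B)
    (hres : ∀ x : B, ∃ c : k, x - algebraMap k B c ∈ m) :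
    ∃ (N : ℕ) (g : Fin N → B), (∀ i, g i ∈ m) ∧
      Algebra.adjoin k (Set.range fun i => (g i : K)) = B := by
  classical
  obtain ⟨t, ht⟩ := hFG
  have htB : ∀ x ∈ t, x ∈ B := fun x hx => ht ▸ Algebra.subset_adjoin hx
  let f : Fin t.card → K := fun i => (t.equivFin.symm i : K)
  have hf : ∀ i, f i ∈ t := fun i => (t.equivFin.symm i).2
  have hfsurj : ∀ x ∈ t, ∃ i, f i = x := fun x hx =>
    ⟨t.equivFin ⟨x, hx⟩, by simp [f]⟩
  choose c hc using fun i => hres ⟨f i, htB _ (hf i)⟩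
  refine ⟨t.card, fun i => ⟨f i, htB _ (hf i)⟩ - algebraMap k B (c i), fun i => hc i, ?_⟩
  apply le_antisymm
  · rw [Algebra.adjoin_le_iff]
    rintro _ ⟨i, rfl⟩
    exact SetLike.coe_mem _
  · refine ht.symm.trans_le ?_
    rw [Algebra.adjoin_le_iff]
    intro x hx
    obtain ⟨i, rfl⟩ := hfsurj x hx
    have : f i = ((⟨f i, htB _ (hf i)⟩ - algebraMap k B (c i) : B) : K) +
        algebraMap k K (c i) := by
      simp
    rw [this]
    exact Subalgebra.add_mem _ (Algebra.subset_adjoin ⟨i, rfl⟩) (Subalgebra.algebraMap_mem _ _)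

end General

section Main

variable {k K : Type} [Field k] [Field K] [Algebra k K]

/-- **`RtdLocal`, unfolded**: for `B ⊆ K` finitely generated, `0 ≠ s ∈ B`, `B' = B[s⁻¹]` and a
proper ideal `m'` of `B'`, the route's `Rtd B' m' r` holds iff `Rtd B (m' ∩ B) r` does. -/
theorem rtdLocal_iff (B : Subalgebra k K) (s : K) (hs : s ∈ B) (hs0 : s ≠ 0) (hB : B.FG)
    (hle : B ≤ Algebra.adjoin k ((B : Set K) ∪ {s⁻¹}))
    (m' : Ideal ↥(Algebra.adjoin k ((B : Set K) ∪ {s⁻¹}))) (hm' : m' ≠ ⊤) (r : ℕ) :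
    (∃ (n : ℕ) (g : Fin n → ↥(Algebra.adjoin k ((B : Set K) ∪ {s⁻¹}))), (∀ i, g i ∈ m') ∧
      Algebra.adjoin k (Set.range fun i => (g i : K)) = Algebra.adjoin k ((B : Set K) ∪ {s⁻¹}) ∧
      ∃ W : Submodule k (Fin n → k), r ≤ Module.finrank k W ∧
        ∃ φ : {α : ↥(Algebra.adjoin k ((B : Set K) ∪ {s⁻¹})) →ₐ[k] HahnSeries ℚ k //
              ∀ b ∈ m', 0 < (α b).orderTop} → Fin n → HahnSeries ℚ k,
          (∀ a b : {α : ↥(Algebra.adjoin k ((B : Set K) ∪ {s⁻¹})) →ₐ[k] HahnSeries ℚ k //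
              ∀ b ∈ m', 0 < (α b).orderTop}, a ≠ b → ∃ j, ∀ i,
            (a.1 (g j) - b.1 (g j)).orderTop <
              ((φ a i - φ b i) - (a.1 (g i) - b.1 (g i))).orderTop) ∧
          (∀ a i, 0 < (φ a i).orderTop) ∧
          (∀ a (w : Fin n → HahnSeries ℚ k), (∀ i, 0 < (w i).orderTop) →
            w ∈ Submodule.span (HahnSeries ℚ k)
              ((fun u : Fin n → k => fun i => HahnSeries.C (u i)) '' (W : Set (Fin n → k))) →
            ∃ b, φ b = φ a + w)) ↔
    (∃ (n : ℕ) (g : Fin n → ↥B), (∀ i, g i ∈ m'.comap (Subalgebra.inclusion hle)) ∧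
      Algebra.adjoin k (Set.range fun i => (g i : K)) = B ∧
      ∃ W : Submodule k (Fin n → k), r ≤ Module.finrank k W ∧
        ∃ φ : {α : ↥B →ₐ[k] HahnSeries ℚ k //
              ∀ b ∈ m'.comap (Subalgebra.inclusion hle), 0 < (α b).orderTop} →
            Fin n → HahnSeries ℚ k,
          (∀ a b : {α : ↥B →ₐ[k] HahnSeries ℚ k //
              ∀ b ∈ m'.comap (Subalgebra.inclusion hle), 0 < (α b).orderTop}, a ≠ b → ∃ j, ∀ i,
            (a.1 (g j) - b.1 (g j)).orderTop <
              ((φ a i - φ b i) - (a.1 (g i) - b.1 (g i))).orderTop) ∧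
          (∀ a i, 0 < (φ a i).orderTop) ∧
          (∀ a (w : Fin n → HahnSeries ℚ k), (∀ i, 0 < (w i).orderTop) →
            w ∈ Submodule.span (HahnSeries ℚ k)
              ((fun u : Fin n → k => fun i => HahnSeries.C (u i)) '' (W : Set (Fin n → k))) →
            ∃ b, φ b = φ a + w)) := by
  classical
  -- `s`, `s⁻¹` in `B'` and the contraction `m := m' ∩ B`
  have hinv : (s⁻¹ : K) ∈ Algebra.adjoin k ((B : Set K) ∪ {s⁻¹}) :=
    Algebra.subset_adjoin (Set.mem_union_right _ rfl)
  have hunit : IsUnit (Subalgebra.inclusion hle ⟨s, hs⟩) := by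
    refine isUnit_iff_exists_inv.2 ⟨⟨s⁻¹, hinv⟩, Subtype.ext ?_⟩
    simp [mul_inv_cancel₀ hs0]
  have hsm : (⟨s, hs⟩ : ↥B) ∉ m'.comap (Subalgebra.inclusion hle) := fun h =>
    hm' (Ideal.eq_top_of_isUnit_mem m' h hunit)
  have key : (∀ x : ↥B, ∃ c : k, x - algebraMap k ↥B c ∈ m'.comap (Subalgebra.inclusion hle)) →
      ∃ c : k, c ≠ 0 ∧ (⟨s, hs⟩ : ↥B) - algebraMap k ↥B c ∈ m'.comap (Subalgebra.inclusion hle) := by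
    intro hres
    obtain ⟨c, hc⟩ := hres ⟨s, hs⟩
    refine ⟨c, ?_, hc⟩
    rintro rfl
    apply hsm
    simpa using hc
  constructor
  · -- (→) from `B' = B[s⁻¹]` down to `B`
    rintro ⟨n', g', hg'm, hg'gen, hR'⟩
    have hg'top := fin_adjoin_top _ g' hg'gen
    have hres' := fin_residue m' g' hg'm hg'top
    have hres : ∀ x : ↥B, ∃ c : k,
        x - algebraMap k ↥B c ∈ m'.comap (Subalgebra.inclusion hle) := fun x => by
      obtain ⟨c, hc⟩ := hres' (Subalgebra.inclusion hle x)
      refine ⟨c, ?_⟩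
      rw [Ideal.mem_comap, map_sub, AlgHom.commutes]
      exact hc
    obtain ⟨c, hc0, hc⟩ := key hres
    have hne := fin_nonempty_arc m' hm' hres'
    obtain ⟨n₀, g₀, hg₀m, hg₀gen⟩ := fin_exists_presentation B hB _ hres
    -- `g' ≡ N (incl ∘ g₀) (mod m'²)`
    have hN : ∀ j, ∃ u : Fin n₀ → k, g' j - ∑ j', algebraMap k _ (u j') *
        Subalgebra.inclusion hle (g₀ j') ∈ m' ^ 2 := fun j =>
      stub_cotangent_span B s hs hs0 hle m' hm' hres' g₀ hg₀m hg₀gen (g' j) (hg'm j)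
    choose N hN using hN
    have hinv := (stub_invariance m' hm' g' hg'm hg'top
      (fun j' => Subalgebra.inclusion hle (g₀ j')) (fun j' => hg₀m j') N hN hne r).mp hR'
    obtain ⟨e, he⟩ := stub_arcEquiv B s hs hs0 hle m' c hc0 hc
    refine ⟨n₀, g₀, hg₀m, hg₀gen, ?_⟩
    exact fin_reindexArcs e.symm
      (fun (a' : {α : ↥(Algebra.adjoin k ((B : Set K) ∪ {s⁻¹})) →ₐ[k] HahnSeries ℚ k //
          ∀ b ∈ m', 0 < (α b).orderTop}) j' => a'.1 (Subalgebra.inclusion hle (g₀ j')))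
      (fun (a : {α : ↥B →ₐ[k] HahnSeries ℚ k //
          ∀ b ∈ m'.comap (Subalgebra.inclusion hle), 0 < (α b).orderTop}) j' => a.1 (g₀ j'))
      (fun a' j' => by rw [← he (e.symm a') (g₀ j'), Equiv.apply_symm_apply]) r hinv
  · -- (←) from `B` up to `B' = B[s⁻¹]`
    rintro ⟨n₁, g, hgm, hggen, hR⟩
    have hgtop := fin_adjoin_top _ g hggen
    have hres := fin_residue (m'.comap (Subalgebra.inclusion hle)) g hgm hgtop
    obtain ⟨c, hc0, hc⟩ := key hres
    -- the extra generator `u := s⁻¹ - c⁻¹ ∈ m'`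
    obtain ⟨u, hu⟩ : ∃ u : ↥(Algebra.adjoin k ((B : Set K) ∪ {s⁻¹})),
        u = ⟨s⁻¹, hinv⟩ - algebraMap k _ c⁻¹ := ⟨_, rfl⟩
    have huK : (u : K) = s⁻¹ - algebraMap k K c⁻¹ := by
      rw [hu]
      simp
    have hum : u ∈ m' := by
      have hd : Subalgebra.inclusion hle ((⟨s, hs⟩ : ↥B) - algebraMap k ↥B c) ∈ m' := hc
      have hueq : u = -(algebraMap k _ c⁻¹ * ⟨s⁻¹, hinv⟩) *
          Subalgebra.inclusion hle ((⟨s, hs⟩ : ↥B) - algebraMap k ↥B c) := by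
        apply Subtype.ext
        have hc0' : (algebraMap k K c) ≠ 0 := (map_ne_zero _).2 hc0
        rw [huK]
        simp only [map_sub, AlgHom.commutes, Subalgebra.coe_mul, Subalgebra.coe_neg,
          Subalgebra.coe_sub, Subalgebra.coe_algebraMap, Subalgebra.coe_inclusion, map_inv₀]
        field_simp
        ring
      rw [hueq]
      exact m'.mul_mem_left _ hd
    -- the presentation `G := (u, incl ∘ g)` of `B'` inside `m'`
    obtain ⟨G, hG⟩ : ∃ G : Fin (n₁ + 1) → ↥(Algebra.adjoin k ((B : Set K) ∪ {s⁻¹})),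
        G = Fin.cons u (fun i => Subalgebra.inclusion hle (g i)) := ⟨_, rfl⟩
    have hG0 : G 0 = u := by rw [hG, Fin.cons_zero]
    have hGs : ∀ i : Fin n₁, G i.succ = Subalgebra.inclusion hle (g i) := fun i => by
      rw [hG, Fin.cons_succ]
    have hGm : ∀ i, G i ∈ m' := by
      refine Fin.cases ?_ (fun i => ?_)
      · rw [hG0]; exact hum
      · rw [hGs]; exact hgm i
    have hGgen : Algebra.adjoin k (Set.range fun i => (G i : K)) =
        Algebra.adjoin k ((B : Set K) ∪ {s⁻¹}) := by
      apply le_antisymm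
      · rw [Algebra.adjoin_le_iff]
        rintro _ ⟨i, rfl⟩
        exact SetLike.coe_mem _
      · rw [Algebra.adjoin_le_iff]
        rintro y (hy | hy)
        · have hy' : y ∈ Algebra.adjoin k (Set.range fun i => (g i : K)) := by rwa [hggen]
          refine Algebra.adjoin_mono ?_ hy'
          rintro _ ⟨i, rfl⟩
          exact ⟨i.succ, by simp [hGs]⟩
        · rw [Set.mem_singleton_iff] at hy
          subst hy
          have : (s⁻¹ : K) = (G 0 : K) + algebraMap k K c⁻¹ := by
            rw [hG0, huK]
            ring
          have hmem : (G 0 : K) + algebraMap k K c⁻¹ ∈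
              Algebra.adjoin k (Set.range fun i => (G i : K)) :=
            add_mem (Algebra.subset_adjoin ⟨0, rfl⟩) (Subalgebra.algebraMap_mem _ _)
          rwa [← this] at hmem
    have hGtop := fin_adjoin_top _ G hGgen
    have hres' := fin_residue m' G hGm hGtop
    have hne := fin_nonempty_arc m' hm' hres'
    -- `G ≡ N (incl ∘ g) (mod m'²)`: the congruence for `u`, identity rows for the rest
    obtain ⟨μ, hμ⟩ := stub_cotangent_span B s hs hs0 hle m' hm' hres' g hgm hggen u hum
    obtain ⟨N, hN⟩ : ∃ N : Fin (n₁ + 1) → Fin n₁ → k,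
        N = Fin.cons μ (fun i => Pi.single i 1) := ⟨_, rfl⟩
    have hNG : ∀ i, G i - ∑ j', algebraMap k _ (N i j') *
        Subalgebra.inclusion hle (g j') ∈ m' ^ 2 := by
      refine Fin.cases ?_ (fun i => ?_)
      · rw [hG0, hN, Fin.cons_zero]
        exact hμ
      · rw [hGs, hN, Fin.cons_succ]
        have hsum : ∑ j', algebraMap k (↥(Algebra.adjoin k ((B : Set K) ∪ {s⁻¹})))
            (Pi.single (M := fun _ => k) i 1 j') * Subalgebra.inclusion hle (g j') =
            Subalgebra.inclusion hle (g i) := by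
          rw [Fintype.sum_eq_single i fun j hj => by
            rw [Pi.single_eq_of_ne hj, map_zero, zero_mul]]
          rw [Pi.single_eq_same, map_one, one_mul]
        rw [hsum, sub_self]
        exact zero_mem _
    obtain ⟨e, he⟩ := stub_arcEquiv B s hs hs0 hle m' c hc0 hc
    have hR₁ := fin_reindexArcs e
      (fun (a : {α : ↥B →ₐ[k] HahnSeries ℚ k //
          ∀ b ∈ m'.comap (Subalgebra.inclusion hle), 0 < (α b).orderTop}) j' => a.1 (g j'))
      (fun (a' : {α : ↥(Algebra.adjoin k ((B : Set K) ∪ {s⁻¹})) →ₐ[k] HahnSeries ℚ k //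
          ∀ b ∈ m', 0 < (α b).orderTop}) j' => a'.1 (Subalgebra.inclusion hle (g j')))
      (fun a j' => he a (g j')) r hR
    have hinv := (stub_invariance m' hm' G hGm hGtop
      (fun j' => Subalgebra.inclusion hle (g j')) (fun j' => hgm j') N hNG hne r).mpr hR₁
    exact ⟨n₁ + 1, G, hGm, hGgen, hinv⟩

end Main

open Summit.ResolutionOfSingularities.ResolutionOfSingularities.Theses.RisoStrata in
/-- **The crux `RtdLocal` of route RisoStrata** (stmt-ResolutionOfSingularities-18840; Monreal,
arXiv:2606.12554, Prop 4.2 / 4.4 + Cor 4.6 in the route's typed encoding): the typed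
riso-triviality dimension of `B[s⁻¹]` at a maximal ideal `m'` equals that of `B` at
`m' ∩ B`. Line `Sketch`, cotangent-invariance proof. -/
theorem RtdLocal_of : RtdLocal := by
  intro p _ k _ _ _ K _ _ B s hs hs0 hB
  dsimp only
  intro m' hm' r
  exact rtdLocal_iff B s hs hs0 hB _ m' hm'.ne_top r

end Summit.ResolutionOfSingularities.ResolutionOfSingularities.Theorems
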